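import Summits.CriticalPhenomena.PercolationContinuityZ3.Theorems.FK.NewmanCLT
import Summits.CriticalPhenomena.PercolationContinuityZ3.Theorems.FK.SubcriticalEdgeCountVariance
import Summits.CriticalPhenomena.PercolationContinuityZ3.Theorems.FK.InfiniteVolumeFKG
import Literature.Probability.Percolation.GluingFinalEstimates
import HarnessLib

/-!
# CENTRAL LIMIT THEOREM FOR THE OPEN-EDGE COUNT OF THE RANDOM-CLUSTER MEASURE `φ^b_{p,q}` BELOW `p_c(q)`
# (`d ≥ 2`, `q ≥ 1`, `0 ≤ p < p_c(q)`, both boundary conditions `b`): `(S_n − E S_n)/√|Λ_n| ⇒ N(0, σ²(p,q,d))`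

Claimed R42 (8)(c) in the cell INBOX at 2026-08-28T13:11:28Z by fkp-10a gen 354 (NEW CLAIM #1 of the gen), under provision (ι) (no coordinator seated since gen 272's closing line l.8385: the lane lead absorbs the registry word, silence = consent; readers fk-ref / fkt-lead / fkp-18r / fkp-10b); lineage row FO-10a-g354 (self-suggested), package g354-newmanclt, label NC-E.
Helper file of the `fk-continuity` build cell (bschramm lane; `--supports stmt-CriticalPhenomena-4575`); builds on
p205010 (kernel theorem, internal audit signed; external expert review pending). No definitions, no named facts, no
sorries; standard axioms. UNCONDITIONAL.

Newman's theorem (1980, Thm. 2; tree: `NewmanCLT.tendstoInDistribution_boxSum`) applied to the field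
`X_z(ω) = #{i : ⟨z, z + e_i⟩ open} = Σ_{i<d} 1{⟨z, z+e_i⟩ ∈ ω}` of the infinite-volume random-cluster measures
`φ^b_{p,q} = rcLimit d b p q` (Grimmett 2006, Thm. (4.19)): the three hypotheses are (C) positive association
(tree: `isPositivelyAssociated_rcLimit`, Thm. (4.17)(b)), (B) translation invariance (tree:
`IsBoxLimit.measurePreserving_relabel_shift`, Thm. (4.19)(b)) giving `Cov(X_x, X_y) = γ(y − x)`
(`covariance_coordEdgeCount_eq`), and (D) finite susceptibility `Σ_z γ(z) < ∞` — below `p_c(q)` the edge–edge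
covariances decay exponentially (tree: `exists_exp_edgeCov_of_lt_rcCriticalProb`, Alexander's weak mixing (1.1) via
Duminil-Copin–Raoufi–Tassion sharpness), so `|γ(z)| ≤ 4d²e^{2c}e^{−c‖z‖_∞}` is summable
(`summable_covariance_coordEdgeCount`). Conclusion: with `S_n = Σ_{(x,i)∈Λ_n×[d]} 1{⟨x,x+e_i⟩ open}` the number of
open coordinate edges based in `Λ_n`,

* `tendsto_charFun_coordEdgeCount` — `E_{φ^b} exp(it(S_n − E S_n)/√|Λ_n|) → exp(−σ²t²/2)`;
* `tendstoInDistribution_coordEdgeCount` — `(S_n − E S_n)/√|Λ_n| → N(0, σ²)` in distribution,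
  `σ² = σ²(p,q,d,b) = Σ_{z∈ℤ^d} Cov_{φ^b}(X_0, X_z) ∈ [0, ∞)` (Newman's "infinite temperature fixed point" variance `A`).

For `q = 2` this is the energy CLT of the Ising model's FK representation below `β_c`; for `q = 1` the classical CLT
for Bernoulli bond percolation edge counts. Positivity of `σ²` (it is `≥ Var X_0 · …`, in fact `≥ γ(0) > 0` for
`0 < p < 1`) is not asserted here.

## References

* C. M. Newman, *Normal fluctuations and the FKG inequalities*, Comm. Math. Phys. 74 (1980) 119–128, Thm. 2.
  [Newman1980]
* G. Grimmett, *The Random-Cluster Model*, Springer 2006, Thm. (4.17)(b), Thm. (4.19)(b), §2.5 (2.45). [Grimmett2006]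
* K. S. Alexander, *On weak mixing in lattice models*, PTRF 110 (1998) 441–471, (1.1). [Alexander1998]
* H. Duminil-Copin, A. Raoufi, V. Tassion, Ann. of Math. 189 (2019), Thm. 1.2 (1). [DuminilCopinRaoufiTassion2019]
-/

noncomputable section

namespace Summit.CriticalPhenomena.PercolationContinuityZ3.Theorems.FK

namespace NewmanCLT

open MeasureTheory ProbabilityTheory Complex Finset Filter Topology
open Literature.Probability.Percolation Literature.Probability.LatticeModels Literature.Barriers.CriticalPhenomena
open BoundaryInfluence

variable {d : ℕ} {p q : ℝ}

/-! ### The coordinate-edge field `X_z = Σ_i 1{⟨z, z+e_i⟩ open}` -/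

/-- One-edge indicators are measurable. [folklore] -/
theorem measurable_indicator_coordEdge (z : Site d) (i : Fin d) :
    Measurable fun ω : BondConfig (Site d) =>
      ({ω' : BondConfig (Site d) | s(z, z + Pi.single i 1) ∈ ω'}).indicator (1 : BondConfig (Site d) → ℝ) ω :=
  measurable_const.indicator (measurableSet_of_isLocalEvent_holds (isLocalEvent_setOf_mem _))

/-- The coordinate-edge count at a site is measurable. [folklore] -/
theorem measurable_coordEdgeCount (z : Site d) :
    Measurable fun ω : BondConfig (Site d) => ∑ i : Fin d,
      ({ω' : BondConfig (Site d) | s(z, z + Pi.single i 1) ∈ ω'}).indicator (1 : BondConfig (Site d) → ℝ) ω :=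
  Finset.measurable_sum _ fun i _ => measurable_indicator_coordEdge z i

/-- One-edge indicators are increasing in the configuration. [cite: Grimmett2006, §2.1] -/
theorem monotone_indicator_coordEdge (z : Site d) (i : Fin d) :
    Monotone fun ω : BondConfig (Site d) =>
      ({ω' : BondConfig (Site d) | s(z, z + Pi.single i 1) ∈ ω'}).indicator (1 : BondConfig (Site d) → ℝ) ω := by
  intro ω ω' hle
  dsimp only
  by_cases h : s(z, z + Pi.single i 1) ∈ ω
  · have h' : s(z, z + Pi.single i 1) ∈ ω' := hle h
    simp [h, h']
  · have h0 : ({ω' : BondConfig (Site d) | s(z, z + Pi.single i 1) ∈ ω'}).indicator (1 : BondConfig (Site d) → ℝ) ω = 0 :=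
      Set.indicator_of_notMem (by exact h) _
    rw [h0]
    exact Set.indicator_nonneg (fun _ _ => zero_le_one) _

/-- The coordinate-edge count is increasing in the configuration. [cite: Grimmett2006, §2.1] -/
theorem monotone_coordEdgeCount (z : Site d) :
    Monotone fun ω : BondConfig (Site d) => ∑ i : Fin d,
      ({ω' : BondConfig (Site d) | s(z, z + Pi.single i 1) ∈ ω'}).indicator (1 : BondConfig (Site d) → ℝ) ω :=
  fun _ _ hle => Finset.sum_le_sum fun i _ => monotone_indicator_coordEdge z i hle

/-- `0 ≤ X_z ≤ d`, so `|X_z| ≤ d`. [folklore] -/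
theorem abs_coordEdgeCount_le (z : Site d) (ω : BondConfig (Site d)) :
    |∑ i : Fin d, ({ω' : BondConfig (Site d) | s(z, z + Pi.single i 1) ∈ ω'}).indicator (1 : BondConfig (Site d) → ℝ) ω|
      ≤ d := by
  refine (Finset.abs_sum_le_sum_abs _ _).trans ?_
  calc _ ≤ ∑ _i : Fin d, (1 : ℝ) := Finset.sum_le_sum fun i _ => abs_indicator_one_le_one _ _
    _ = d := by simp

/-! ### (B) Translation covariance of the covariances -/

/-- Translating the field: `X_z(ω − x) = X_{z+x}(ω)` for the shift `ω ↦ ω − x` of configurations.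
[cite: Grimmett2006, Thm. (4.19)(b)] -/
theorem coordEdgeCount_comp_relabel_shift (x z : Site d) (ω : BondConfig (Site d)) :
    (∑ i : Fin d, ({ω' : BondConfig (Site d) | s(z, z + Pi.single i 1) ∈ ω'}).indicator (1 : BondConfig (Site d) → ℝ)
        (BondConfig.relabel (sym2Equiv (Site.shift (-x))) ω)) =
      ∑ i : Fin d, ({ω' : BondConfig (Site d) | s(z + x, z + x + Pi.single i 1) ∈ ω'}).indicator
        (1 : BondConfig (Site d) → ℝ) ω := by
  classical
  refine Finset.sum_congr rfl fun i _ => ?_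
  have hiff := mem_preimage_relabel_shift_neg_setOf_pair_mem_iff x z (z + Pi.single i 1) ω
  rw [Set.mem_preimage, Set.mem_setOf_eq, show z + Pi.single i 1 + x = z + x + Pi.single i 1 by abel] at hiff
  simp only [Set.indicator_apply, Set.mem_setOf_eq, hiff, Pi.one_apply]

/-- **(B) for `φ^b_{p,q}`**: `Cov_{φ^b}(X_x, X_y) = Cov_{φ^b}(X_0, X_{y−x})` (translation invariance of the box limits,
Grimmett Thm. (4.19)(b), transported to covariances). [cite: Grimmett2006, Thm. (4.19)(b)] -/
theorem covariance_coordEdgeCount_eq (b : Bool) (hp : p ∈ Set.Icc (0 : ℝ) 1) (hq : 1 ≤ q) (x y : Site d) :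
    cov[fun ω => ∑ i : Fin d, ({ω' : BondConfig (Site d) | s(x, x + Pi.single i 1) ∈ ω'}).indicator
        (1 : BondConfig (Site d) → ℝ) ω,
      fun ω => ∑ i : Fin d, ({ω' : BondConfig (Site d) | s(y, y + Pi.single i 1) ∈ ω'}).indicator
        (1 : BondConfig (Site d) → ℝ) ω; rcLimit d b p q] =
    cov[fun ω => ∑ i : Fin d, ({ω' : BondConfig (Site d) | s((0 : Site d), 0 + Pi.single i 1) ∈ ω'}).indicator
        (1 : BondConfig (Site d) → ℝ) ω,
      fun ω => ∑ i : Fin d, ({ω' : BondConfig (Site d) | s(y - x, y - x + Pi.single i 1) ∈ ω'}).indicator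
        (1 : BondConfig (Site d) → ℝ) ω; rcLimit d b p q] := by
  have hT := (isBoxLimit_rcLimit b hp hq).measurePreserving_relabel_shift hp hq (-x)
  conv_rhs => rw [← hT.map_eq]
  rw [covariance_map_fun (measurable_coordEdgeCount _).aestronglyMeasurable
    (measurable_coordEdgeCount _).aestronglyMeasurable hT.measurable.aemeasurable]
  simp_rw [coordEdgeCount_comp_relabel_shift]
  simp only [zero_add, sub_add_cancel]

/-! ### (D) Finite susceptibility below `p_c(q)` -/

/-- The covariance of two indicators is `P(A ∩ B) − P(A)P(B)`. [cite: Grimmett2006, §2.5 (2.45)] -/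
theorem covariance_indicator_one_eq {Ω : Type*} [MeasurableSpace Ω] (P : Measure Ω) [IsProbabilityMeasure P]
    {A B : Set Ω} (hA : MeasurableSet A) (hB : MeasurableSet B) :
    cov[A.indicator (1 : Ω → ℝ), B.indicator (1 : Ω → ℝ); P] = P.real (A ∩ B) - P.real A * P.real B := by
  rw [covariance]
  simp only [integral_indicator_one hA, integral_indicator_one hB]
  exact integral_indicator_sub_mul_indicator_sub P hA hB

/-- **Covariance decay for the coordinate-edge counts below `p_c(q)`**: `|Cov_{φ^b}(X_0, X_z)| ≤ 4d²e^{2c}·e^{−c‖z‖_∞}`.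
[cite: Alexander1998, (1.1); Grimmett2006, §2.5 (2.45); DuminilCopinRaoufiTassion2019, Thm. 1.2 (1)] -/
theorem exists_abs_covariance_coordEdgeCount_le (hd : 2 ≤ d) (hq : 1 ≤ q) (hp0 : 0 ≤ p) (hpc : p < rcCriticalProb d q) :
    ∃ c : ℝ, 0 < c ∧ ∀ (b : Bool) (z : Site d),
      |cov[fun ω => ∑ i : Fin d, ({ω' : BondConfig (Site d) | s((0 : Site d), 0 + Pi.single i 1) ∈ ω'}).indicator
          (1 : BondConfig (Site d) → ℝ) ω,
        fun ω => ∑ j : Fin d, ({ω' : BondConfig (Site d) | s(z, z + Pi.single j 1) ∈ ω'}).indicator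
          (1 : BondConfig (Site d) → ℝ) ω; rcLimit d b p q]| ≤
        4 * (d : ℝ) ^ 2 * Real.exp (2 * c) * Real.exp (-(c * siteRad z)) := by
  obtain ⟨c, hc, h⟩ := exists_exp_edgeCov_of_lt_rcCriticalProb hd hq hp0 hpc
  refine ⟨c, hc, fun b z => ?_⟩
  haveI := isProbabilityMeasure_rcLimit (d := d) b p q
  have hm : ∀ (w : Site d) (i : Fin d), MemLp (({ω' : BondConfig (Site d) | s(w, w + Pi.single i 1) ∈ ω'}).indicator
      (1 : BondConfig (Site d) → ℝ)) 2 (rcLimit d b p q) := fun w i =>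
    memLp_of_abs_le (measurable_indicator_coordEdge w i) (fun ω => abs_indicator_one_le_one _ ω) 2
  rw [covariance_fun_sum_fun_sum' (fun i _ => hm 0 i) (fun j _ => hm z j)]
  refine (Finset.abs_sum_le_sum_abs _ _).trans ?_
  refine (Finset.sum_le_sum fun i _ => Finset.abs_sum_le_sum_abs _ _).trans ?_
  have hterm : ∀ i j : Fin d, |cov[({ω' : BondConfig (Site d) | s((0 : Site d), 0 + Pi.single i 1) ∈ ω'}).indicator
      (1 : BondConfig (Site d) → ℝ), ({ω' : BondConfig (Site d) | s(z, z + Pi.single j 1) ∈ ω'}).indicator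
      (1 : BondConfig (Site d) → ℝ); rcLimit d b p q]| ≤ 4 * Real.exp (2 * c) * Real.exp (-(c * siteRad z)) := by
    intro i j
    rw [covariance_indicator_one_eq _ (measurableSet_of_isLocalEvent_holds (isLocalEvent_setOf_mem _))
      (measurableSet_of_isLocalEvent_holds (isLocalEvent_setOf_mem _))]
    simpa using h b 0 z i j
  calc _ ≤ ∑ _i : Fin d, ∑ _j : Fin d, 4 * Real.exp (2 * c) * Real.exp (-(c * siteRad z)) :=
        Finset.sum_le_sum fun i _ => Finset.sum_le_sum fun j _ => hterm i j
    _ = 4 * (d : ℝ) ^ 2 * Real.exp (2 * c) * Real.exp (-(c * siteRad z)) := by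
        rw [Finset.sum_const, Finset.sum_const, Finset.card_univ, Fintype.card_fin, nsmul_eq_mul, nsmul_eq_mul]; ring

/-- `z ↦ e^{−c‖z‖_∞}` is summable over `ℤ^d` (`c > 0`): its partial sums are bounded by `Σ_m (2m+1)^d e^{−cm}`.
[folklore] -/
theorem summable_exp_neg_mul_siteRad {c : ℝ} (hc : 0 < c) : Summable fun z : Site d => Real.exp (-(c * siteRad z)) := by
  refine summable_of_sum_le (c := ∑' m : ℕ, ((2 * m + 1 : ℕ) : ℝ) ^ d * Real.exp (-(c * m)))
    (fun z => (Real.exp_pos _).le) fun u => ?_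
  obtain ⟨N, hN⟩ := (eventually_subset_box_holds (d := d) u).exists
  exact (Finset.sum_le_sum_of_subset_of_nonneg hN fun z _ _ => (Real.exp_pos _).le).trans (sum_exp_neg_siteRad_le hc N)

/-- **(D) finite susceptibility below `p_c(q)`**: `z ↦ Cov_{φ^b}(X_0, X_z)` is summable for `0 ≤ p < p_c(q)`, `d ≥ 2`,
`q ≥ 1`. [cite: Newman1980, Thm. 2 (D); Alexander1998, (1.1); DuminilCopinRaoufiTassion2019, Thm. 1.2 (1)] -/
theorem summable_covariance_coordEdgeCount (hd : 2 ≤ d) (hq : 1 ≤ q) (hp0 : 0 ≤ p) (hpc : p < rcCriticalProb d q)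
    (b : Bool) :
    Summable fun z : Site d => cov[fun ω => ∑ i : Fin d,
        ({ω' : BondConfig (Site d) | s((0 : Site d), 0 + Pi.single i 1) ∈ ω'}).indicator (1 : BondConfig (Site d) → ℝ) ω,
      fun ω => ∑ j : Fin d, ({ω' : BondConfig (Site d) | s(z, z + Pi.single j 1) ∈ ω'}).indicator
        (1 : BondConfig (Site d) → ℝ) ω; rcLimit d b p q] := by
  obtain ⟨c, hc, h⟩ := exists_abs_covariance_coordEdgeCount_le hd hq hp0 hpc
  refine Summable.of_norm_bounded ((summable_exp_neg_mul_siteRad (d := d) hc).mul_left (4 * (d : ℝ) ^ 2 * Real.exp (2 * c)))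
    fun z => ?_
  rw [Real.norm_eq_abs]
  exact h b z

/-! ### The central limit theorem -/

/-- **CLT FOR THE OPEN-EDGE COUNT OF `φ^b_{p,q}` BELOW `p_c(q)`, characteristic-function form**: for `d ≥ 2`, `q ≥ 1`,
`0 ≤ p < p_c(q)`, both `b`, and every real `t`, with `S_n(ω) = Σ_{x∈Λ_n} Σ_{i<d} 1{⟨x, x+e_i⟩ ∈ ω}`:
`E_{φ^b} exp(it(S_n − E S_n)/√|Λ_n|) → exp(−σ²t²/2)`, `σ² = Σ_z Cov_{φ^b}(X_0, X_z)`.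
[cite: Newman1980, Thm. 2; Grimmett2006, Thm. (4.17)(b), Thm. (4.19)(b)] -/
theorem tendsto_charFun_coordEdgeCount (hd : 2 ≤ d) (hq : 1 ≤ q) (hp0 : 0 ≤ p) (hpc : p < rcCriticalProb d q)
    (b : Bool) (t : ℝ) :
    Tendsto (fun n : ℕ => ∫ ω, cexp ((((t / Real.sqrt #(box d n)) *
        (∑ z ∈ box d n, ∑ i : Fin d, ({ω' : BondConfig (Site d) | s(z, z + Pi.single i 1) ∈ ω'}).indicator
            (1 : BondConfig (Site d) → ℝ) ω -
          ∫ ω', ∑ z ∈ box d n, ∑ i : Fin d, ({ω'' : BondConfig (Site d) | s(z, z + Pi.single i 1) ∈ ω''}).indicator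
            (1 : BondConfig (Site d) → ℝ) ω' ∂(rcLimit d b p q)) : ℝ) : ℂ) * I) ∂(rcLimit d b p q))
      atTop (𝓝 ((Real.exp (-((∑' z : Site d, cov[fun ω => ∑ i : Fin d,
        ({ω' : BondConfig (Site d) | s((0 : Site d), 0 + Pi.single i 1) ∈ ω'}).indicator (1 : BondConfig (Site d) → ℝ) ω,
        fun ω => ∑ j : Fin d, ({ω' : BondConfig (Site d) | s(z, z + Pi.single j 1) ∈ ω'}).indicator
          (1 : BondConfig (Site d) → ℝ) ω; rcLimit d b p q]) * t ^ 2 / 2)) : ℝ) : ℂ)) := by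
  have hp : p ∈ Set.Icc (0 : ℝ) 1 := ⟨hp0, (hpc.trans (rcCriticalProb_lt_one hd hq)).le⟩
  haveI := isProbabilityMeasure_rcLimit (d := d) b p q
  have hμ : IsPositivelyAssociated (rcLimit d b p q) := isPositivelyAssociated_rcLimit b hp hq
  -- (B) and (D) in the shape consumed by `NewmanCLT` (positional application; see the module docstring)
  have hcov : ∀ x y : Site d, cov[(fun (z : Site d) (ω : BondConfig (Site d)) => ∑ i : Fin d,
        ({ω' : BondConfig (Site d) | s(z, z + Pi.single i 1) ∈ ω'}).indicator (1 : BondConfig (Site d) → ℝ) ω) x,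
      (fun (z : Site d) (ω : BondConfig (Site d)) => ∑ i : Fin d,
        ({ω' : BondConfig (Site d) | s(z, z + Pi.single i 1) ∈ ω'}).indicator (1 : BondConfig (Site d) → ℝ) ω) y; rcLimit d b p q] =
      (fun (z : Site d) => cov[fun ω => ∑ i : Fin d,
        ({ω' : BondConfig (Site d) | s((0 : Site d), 0 + Pi.single i 1) ∈ ω'}).indicator (1 : BondConfig (Site d) → ℝ) ω,
        fun ω => ∑ j : Fin d, ({ω' : BondConfig (Site d) | s(z, z + Pi.single j 1) ∈ ω'}).indicator
          (1 : BondConfig (Site d) → ℝ) ω; rcLimit d b p q]) (y - x) :=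
    fun x y => covariance_coordEdgeCount_eq b hp hq x y
  have hs : Summable (fun (z : Site d) => cov[fun ω => ∑ i : Fin d,
        ({ω' : BondConfig (Site d) | s((0 : Site d), 0 + Pi.single i 1) ∈ ω'}).indicator (1 : BondConfig (Site d) → ℝ) ω,
        fun ω => ∑ j : Fin d, ({ω' : BondConfig (Site d) | s(z, z + Pi.single j 1) ∈ ω'}).indicator
          (1 : BondConfig (Site d) → ℝ) ω; rcLimit d b p q]) :=
    summable_covariance_coordEdgeCount hd hq hp0 hpc b
  exact tendsto_charFun_boxSum (le_trans one_le_two hd) hμ measurable_coordEdgeCount monotone_coordEdgeCount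
    (Nat.cast_nonneg d) abs_coordEdgeCount_le hcov hs t

/-- **CENTRAL LIMIT THEOREM FOR THE OPEN-EDGE COUNT OF THE RANDOM-CLUSTER MEASURE BELOW `p_c(q)`** (Newman's theorem
for `φ^b_{p,q}`): for `d ≥ 2`, `q ≥ 1`, `0 ≤ p < p_c(q)` and both `b`, the number `S_n` of open coordinate edges
`⟨x, x+e_i⟩`, `(x,i) ∈ Λ_n × [d]`, satisfies `(S_n − E_{φ^b} S_n)/√|Λ_n| → N(0, σ²)` in distribution under `φ^b_{p,q}`,
where `σ² = Σ_{z∈ℤ^d} Cov_{φ^b}(X_0, X_z) ∈ [0,∞)` (`X_z` the edge count at `z`), for any `Y ~ gaussianReal 0 σ²`.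
[cite: Newman1980, Thm. 2; Grimmett2006, Thm. (4.17)(b), Thm. (4.19)(b); Alexander1998, (1.1)] -/
theorem tendstoInDistribution_coordEdgeCount {Ω' : Type*} {mΩ' : MeasurableSpace Ω'} {P' : Measure Ω'}
    [IsProbabilityMeasure P'] {Y : Ω' → ℝ} (hd : 2 ≤ d) (hq : 1 ≤ q) (hp0 : 0 ≤ p) (hpc : p < rcCriticalProb d q)
    (b : Bool) {v : NNReal} (hv : (v : ℝ) = ∑' z : Site d, cov[fun ω => ∑ i : Fin d,
        ({ω' : BondConfig (Site d) | s((0 : Site d), 0 + Pi.single i 1) ∈ ω'}).indicator (1 : BondConfig (Site d) → ℝ) ω,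
        fun ω => ∑ j : Fin d, ({ω' : BondConfig (Site d) | s(z, z + Pi.single j 1) ∈ ω'}).indicator
          (1 : BondConfig (Site d) → ℝ) ω; rcLimit d b p q]) (hY : HasLaw Y (gaussianReal 0 v) P') :
    haveI := isProbabilityMeasure_rcLimit (d := d) b p q
    TendstoInDistribution (fun (n : ℕ) (ω : BondConfig (Site d)) => (Real.sqrt #(box d n))⁻¹ *
        (∑ z ∈ box d n, ∑ i : Fin d, ({ω' : BondConfig (Site d) | s(z, z + Pi.single i 1) ∈ ω'}).indicator
            (1 : BondConfig (Site d) → ℝ) ω -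
          ∫ ω', ∑ z ∈ box d n, ∑ i : Fin d, ({ω'' : BondConfig (Site d) | s(z, z + Pi.single i 1) ∈ ω''}).indicator
            (1 : BondConfig (Site d) → ℝ) ω' ∂(rcLimit d b p q)))
      atTop Y (fun _ => rcLimit d b p q) P' := by
  have hp : p ∈ Set.Icc (0 : ℝ) 1 := ⟨hp0, (hpc.trans (rcCriticalProb_lt_one hd hq)).le⟩
  haveI := isProbabilityMeasure_rcLimit (d := d) b p q
  have hμ : IsPositivelyAssociated (rcLimit d b p q) := isPositivelyAssociated_rcLimit b hp hq
  -- (B) and (D) in the shape consumed by `NewmanCLT` (positional application; see the module docstring)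
  have hcov : ∀ x y : Site d, cov[(fun (z : Site d) (ω : BondConfig (Site d)) => ∑ i : Fin d,
        ({ω' : BondConfig (Site d) | s(z, z + Pi.single i 1) ∈ ω'}).indicator (1 : BondConfig (Site d) → ℝ) ω) x,
      (fun (z : Site d) (ω : BondConfig (Site d)) => ∑ i : Fin d,
        ({ω' : BondConfig (Site d) | s(z, z + Pi.single i 1) ∈ ω'}).indicator (1 : BondConfig (Site d) → ℝ) ω) y; rcLimit d b p q] =
      (fun (z : Site d) => cov[fun ω => ∑ i : Fin d,
        ({ω' : BondConfig (Site d) | s((0 : Site d), 0 + Pi.single i 1) ∈ ω'}).indicator (1 : BondConfig (Site d) → ℝ) ω,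
        fun ω => ∑ j : Fin d, ({ω' : BondConfig (Site d) | s(z, z + Pi.single j 1) ∈ ω'}).indicator
          (1 : BondConfig (Site d) → ℝ) ω; rcLimit d b p q]) (y - x) :=
    fun x y => covariance_coordEdgeCount_eq b hp hq x y
  have hs : Summable (fun (z : Site d) => cov[fun ω => ∑ i : Fin d,
        ({ω' : BondConfig (Site d) | s((0 : Site d), 0 + Pi.single i 1) ∈ ω'}).indicator (1 : BondConfig (Site d) → ℝ) ω,
        fun ω => ∑ j : Fin d, ({ω' : BondConfig (Site d) | s(z, z + Pi.single j 1) ∈ ω'}).indicator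
          (1 : BondConfig (Site d) → ℝ) ω; rcLimit d b p q]) :=
    summable_covariance_coordEdgeCount hd hq hp0 hpc b
  exact tendstoInDistribution_boxSum (le_trans one_le_two hd) hμ measurable_coordEdgeCount monotone_coordEdgeCount
    (Nat.cast_nonneg d) abs_coordEdgeCount_le hcov hs hv hY

end NewmanCLT

end Summit.CriticalPhenomena.PercolationContinuityZ3.Theorems.FK
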